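import Summits.HodgeConjecture.CorCM.GaloisQuaternionKleinFour
import HarnessLib

/-!
# A real CYCLIC QUARTIC factor is fatal as well: `Gal(K/ℚ) ≅ H × C₄`, `c = (c₀, 1)` with `c₀ = h₀²` a square in
# `H` — Weil type over the diagonal `C₄`; `Q_{4n} × C₄` is BAD for every `n`

COR-CM (cell `pub-hodgecm2`), binder seat b04 (gen 23), count-neutral claim CYCLIC-BY-MULTIPLIERS, part VIII (companion
of part VII `CorCM/GaloisKleinFourFactor`, `…QuaternionKleinFour`).  KERNEL ONLY: theorems; no definition, no named
fact, no `sorry`.  `HC_CM` is neither used nor claimed.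

SETTING.  `K/ℚ` Galois CM, `e : Gal(K/ℚ) ≃* H × C₄` (`C₄ = Multiplicative (ZMod 4)`, generator `g = ofAdd 1`),
`e(c) = (c₀, 1)` — `K = K₁ L` with `K₁` Galois CM (group `H`) and `L` a totally real CYCLIC QUARTIC field, disjoint —
and an element `h₀ ∈ H` with `h₀² = c₀`.  From a CM set `Ψ₀ ⊆ H` with trivial left stabiliser pick `p ∈ Ψ₀` with
`h₀ p ∉ Ψ₀` and put `P̂ = {p, c₀p}`, `Q̂ = h₀P̂`.  THE FAMILY `Ψ_1 = Ψ_g = Ψ₀`, `Ψ_{g²} = Ψ₀ △ P̂`, `Ψ_{g³} = Ψ₀ △ Q̂`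
is a primitive CM type of `K` which is EQUIDISTRIBUTED over the right cosets of the diagonal subgroup
`V = ⟨(h₀, g)⟩ ≅ C₄` (`c ∉ V`): `#{m : (h₀^m x, g^m a) ∈ Φ} = 2` for all `(x, a)` — Weil type over the CM subfield
`K^V` of index `4`, hence DEGENERATE (gen 20 certificate format with the balanced set `D = V`).

* §1 `exists_simple_degenerate_of_model_cyclicFour` — the abstract theorem: a SIMPLE DEGENERATE abelian variety of
  dimension `2|H|` with CM by `K`.
* §2 **`exists_simple_degenerate_of_quaternion_cyclicFour`** — `Gal(K/ℚ) ≅ Q_{4n} × C₄`, `c = (aⁿ, 1)`, ANY `n ≥ 1`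
  (`h₀ = xa 0`, `(xa 0)² = aⁿ`; the double interval of part VII-b): BAD.  With parts VII (`× C₂²`) and gen 20
  (`Q_{2^{k+2}} × C₂` GOOD): **a generalized quaternion CM field stays good under exactly one kind of totally real
  Galois factor of degree `≤ 4`, the real quadratic one**.  Also covered: `D₄ × C₄` (`h₀ = r`), `C_{4m} × C₄`;
  consistent with the abelian classification (`C₄ × C₄`, `C₈ × C₄` bad; `C₂² × C₄` — no square root of `c` — is the
  sporadic good class `(γ)`).  Seat census (`scratch/census32`): `Q₈ × C₄` (order 32) has `4288` primitive degenerate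
  types for `c = (a², 1)`, none skew.

## References

* [Shimura1998] G. Shimura, *Abelian Varieties with Complex Multiplication and Modular Functions*, §6.2 Thm. 3,
  §8.2 Prop. 26, §18.2 Lemma (i).
* [Gordon1999HodgeAVSurvey] B. B. Gordon, *A survey of the Hodge conjecture for abelian varieties*, Thm. 6.4, §9.2–9.3.
-/

noncomputable section

open CategoryTheory CategoryTheory.Limits NumberField
open scoped BigOperators

namespace Summit.HodgeConjecture.CorCM.GaloisModels

open Literature.NumberTheory.ComplexMultiplication
open Literature.AlgebraicGeometry.Motives (AbelianVariety CMType)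
open Literature.AlgebraicGeometry.HodgeTheory
open Literature.AlgebraicGeometry.ComplexMultiplication (IsCMTypeRealisation)
open Literature.AlgebraicGeometry.Pohlmann1968
open Literature.Barriers.HodgeConjecture (divisorClassesSpan)
open Summit.HodgeConjecture.CorCM.CyclicAsymmetricHalves
open QuaternionGroup

/-! ## §1 The diagonal-`C₄` Weil type on `H × C₄` -/

section CyclicFour

/-- The four elements of `C₄`. [folklore] -/
theorem cyclicFour_cases (v : (Multiplicative (ZMod 4))) : v = 1 ∨ v = (Multiplicative.ofAdd (1 : ZMod 4)) ∨ v =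
    (Multiplicative.ofAdd (1 : ZMod 4)) * (Multiplicative.ofAdd (1 : ZMod 4)) ∨ v = (Multiplicative.ofAdd (1 : ZMod
    4)) * (Multiplicative.ofAdd (1 : ZMod 4)) * (Multiplicative.ofAdd (1 : ZMod 4)) := by
  revert v; decide

/-- Propositional core of the coset count (the four columns of the Weil-type condition). [folklore] -/
theorem cyclicFour_prop (A B πP πQ : Prop) [Decidable A] [Decidable B] [Decidable πP] [Decidable πQ]
    (hdis : ¬ (πP ∧ πQ)) (hsP : πP → (A ↔ ¬ B)) (hsQ : πQ → (A ↔ B)) :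
    ((if A then 1 else 0) + ((if B then 1 else 0) + ((if (A ↔ πP) then 1 else 0) +
      (if (B ↔ πP) then 1 else 0))) = 2) ∧
    ((if A then 1 else 0) + ((if (B ↔ ¬ πQ) then 1 else 0) + ((if (A ↔ πQ) then 1 else 0) +
      (if ¬ B then 1 else 0))) = 2) ∧
    ((if (A ↔ ¬ πP) then 1 else 0) + ((if (B ↔ ¬ πP) then 1 else 0) + ((if ¬ A then 1 else 0) +
      (if ¬ B then 1 else 0))) = 2) ∧
    ((if (A ↔ ¬ πQ) then 1 else 0) + ((if B then 1 else 0) + ((if ¬ A then 1 else 0) +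
      (if (B ↔ πQ) then 1 else 0))) = 2) := by
  by_cases hA : A <;> by_cases hB : B <;> by_cases hP : πP <;> by_cases hQ : πQ <;> simp_all

/-- Propositional core of the CM property of `Ψ₀ △ E` read through `c₀` (`E` stable under `c₀`). [folklore] -/
theorem symmDiff_cm_prop' (C e : Prop) : (¬ C ↔ ¬ e) ↔ ¬ (C ↔ ¬ e) := by
  by_cases hC : C <;> by_cases he : e <;> simp_all

variable {H : Type*} [Group H] [Fintype H] [DecidableEq H]
variable {K : Type} [Field K] [NumberField K] [IsCMField K] [IsGalois ℚ K]

/-- **THEOREM (cyclic quartic factor).**  `K` Galois CM, `e : Gal(K/ℚ) ≃* H × C₄` with `e(c) =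
    (c₀, 1)`, an element
`h₀ ∈ H` with `h₀² = c₀`, and a CM set `Ψ₀ ⊆ H` for `c₀` with trivial left stabiliser (a primitive CM type of
`K₁ = K^{1 × C₄}`).  Then `K` has a SIMPLE DEGENERATE abelian variety of dimension `2|H|` with
    CM by `K`, with an
exceptional Hodge class on some power: the family `(Ψ₀, Ψ₀, Ψ₀ △ P̂, Ψ₀ △ h₀P̂)` is a primitive type of Weil type over
the fixed field of the diagonal `⟨(h₀, g)⟩ ≅ C₄`. [cite: Shimura1998, §6.2 Thm. 3 and §8.2
    Prop. 26]
[cite: Gordon1999HodgeAVSurvey, Thm. 6.4 and §9.2] -/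
theorem exists_simple_degenerate_of_model_cyclicFour (e : (K ≃ₐ[ℚ] K) ≃* H × (Multiplicative (ZMod 4))) (c₀ : H)
    (hc : e ((IsCMField.complexConj K).restrictScalars ℚ) = (c₀, 1)) (h₀ : H) (hh : h₀ * h₀ = c₀)
    (Ψ₀ : Finset H) (hcm₀ : ∀ x, x ∈ Ψ₀ ↔ c₀ * x ∉ Ψ₀)
    (hprim₀ : ∀ y : H, y ≠ 1 → ∃ w : H, ¬ (w ∈ Ψ₀ ↔ y * w ∈ Ψ₀)) :
    ∃ (Φ : CMType K) (φ₀ : K →+* ℂ) (A : AbelianVariety ℂ) (ι : 𝓞 K →+* End A)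
      (θ : K →+* Module.End ℂ (complexBetti A.X 1)),
      IsPrimitive (ℂ ≃+* ℂ) Φ.1 φ₀ ∧ ¬ IsNondegenerate Φ ∧ IsCMTypeRealisation Φ A ι θ ∧ A.IsSimple ∧
      A.dim = 2 * Fintype.card H ∧
      ∃ n p : ℕ, ∃ x : complexBetti (⨁ fun _ : Fin n => A).X (2 * p), IsRationalClass x ∧
        IsOfHodgeType (⨁ fun _ : Fin n => A).dim (⨁ fun _ : Fin n => A).X (2 * p) p p x ∧
        x ∉ divisorClassesSpan (⨁ fun _ : Fin n => A).X (⨁ fun _ : Fin n => A).dim p := by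
  classical
  have hc1 : c₀ ≠ 1 := fun h1 => GaloisRank.model_complexConj_ne_one e hc (by rw [h1]; rfl)
  have hcc : c₀ * c₀ = 1 := by
    have := GaloisRank.model_complexConj_mul_self e hc
    rw [Prod.mk_mul_mk, mul_one, Prod.mk_eq_one] at this
    exact this.1
  have hcomm : ∀ x : H, c₀ * x = x * c₀ := fun x => by
    have := GaloisRank.model_complexConj_comm e hc (x, 1)
    rw [Prod.mk_mul_mk, Prod.mk_mul_mk, one_mul] at this
    exact (Prod.mk.inj this).1
  have hh1 : h₀ ≠ 1 := fun h1 => hc1 (by rw [← hh, h1, one_mul])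
  -- `p ∈ Ψ₀` with `h₀ p ∉ Ψ₀`
  obtain ⟨p, hpΨ, hhp⟩ : ∃ p, p ∈ Ψ₀ ∧ h₀ * p ∉ Ψ₀ := by
    obtain ⟨w, hw⟩ := hprim₀ h₀ hh1
    by_cases hwΨ : w ∈ Ψ₀
    · exact ⟨w, hwΨ, fun h => hw ⟨fun _ => h, fun _ => hwΨ⟩⟩
    · refine ⟨c₀ * w, (hcm₀ (c₀ * w)).2 (by rwa [← mul_assoc, hcc, one_mul]), fun h => hw ⟨fun h' => absurd h' hwΨ,
        fun h' => ?_⟩⟩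
      have : c₀ * (h₀ * w) ∈ Ψ₀ := by rwa [← mul_assoc, ← hcomm h₀, mul_assoc] at h
      exact absurd this ((hcm₀ (h₀ * w)).1 h')
  -- the pairs `P = {p, c₀p}`, `Q = h₀P`, and the sign facts
  set P : Finset H := {p, c₀ * p} with hP
  set Q : Finset H := {h₀ * p, c₀ * (h₀ * p)} with hQ
  have hc0h : c₀ * h₀ = h₀ * c₀ := hcomm h₀
  have memP : ∀ x, x ∈ P ↔ x = p ∨ x = c₀ * p := fun x => by simp [hP]
  have memQ : ∀ x, x ∈ Q ↔ x = h₀ * p ∨ x = c₀ * (h₀ * p) := fun x => by simp [hQ]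
  have hPQ : ∀ x, x ∈ P ↔ h₀ * x ∈ Q := fun x => by
    rw [memP, memQ]
    constructor
    · rintro (rfl | rfl)
      · exact Or.inl rfl
      · right; rw [← mul_assoc, ← hc0h, mul_assoc]
    · rintro (h | h)
      · exact Or.inl (mul_left_cancel h)
      · right; apply mul_left_cancel (a := h₀); rw [h, ← mul_assoc, hc0h, mul_assoc]
  have hQP : ∀ x, x ∈ Q ↔ h₀ * x ∈ P := fun x => by
    rw [memP, memQ]
    constructor
    · rintro (rfl | rfl)
      · right; rw [← mul_assoc, hh]
      · left; rw [← mul_assoc, ← hc0h, mul_assoc, ← mul_assoc h₀ h₀, hh, ← mul_assoc, hcc, one_mul]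
    · rintro (h | h)
      · right
        have : h₀ * x = h₀ * (c₀ * (h₀ * p)) := by
          rw [h, ← mul_assoc, ← hc0h, mul_assoc, ← mul_assoc h₀ h₀, hh, ← mul_assoc, hcc, one_mul]
        exact mul_left_cancel this
      · left
        have : h₀ * x = h₀ * (h₀ * p) := by rw [h, ← mul_assoc, hh]
        exact mul_left_cancel this
  have hdis : ∀ x, ¬ (x ∈ P ∧ x ∈ Q) := fun x ⟨hxP, hxQ⟩ => by
    rw [memP] at hxP; rw [memQ] at hxQ
    have hp1 : h₀ * p ≠ p := fun h => hh1 (by simpa using congrArg (· * p⁻¹) h)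
    have hp2 : c₀ * (h₀ * p) ≠ p := fun h => by
      have : c₀ * h₀ = 1 := by simpa [mul_assoc] using congrArg (· * p⁻¹) h
      have : h₀ = c₀ := by
        calc h₀ = c₀ * (c₀ * h₀) := by rw [← mul_assoc, hcc, one_mul]
          _ = c₀ := by rw [this, mul_one]
      exact hc1 (by rw [← hh, this, hcc])
    rcases hxP with rfl | rfl <;> rcases hxQ with h | h
    · exact hp1 h.symm
    · exact hp2 h.symm
    · have e1 : c₀ = h₀ := mul_right_cancel h
      exact hc1 (calc c₀ = h₀ * h₀ := hh.symm
        _ = c₀ * c₀ := by rw [← e1]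
        _ = 1 := hcc)
    · exact hp1 (mul_left_cancel h).symm
  -- sign facts on the pairs
  have hcp : c₀ * p ∉ Ψ₀ := (hcm₀ p).1 hpΨ
  have hchp : c₀ * (h₀ * p) ∈ Ψ₀ := not_not.1 fun hn => hhp ((hcm₀ _).2 hn)
  have hsP : ∀ x, x ∈ P → (x ∈ Ψ₀ ↔ h₀ * x ∉ Ψ₀) := fun x hx => by
    rcases (memP x).1 hx with rfl | rfl
    · exact ⟨fun _ => hhp, fun _ => hpΨ⟩
    · have h1 : h₀ * (c₀ * p) ∈ Ψ₀ := by rwa [← mul_assoc, ← hc0h, mul_assoc]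
      exact ⟨fun h => absurd h hcp, fun h => absurd h1 h⟩
  have hsQ : ∀ x, x ∈ Q → (x ∈ Ψ₀ ↔ h₀ * x ∈ Ψ₀) := fun x hx => by
    rcases (memQ x).1 hx with rfl | rfl
    · have h1 : h₀ * (h₀ * p) ∉ Ψ₀ := by rw [← mul_assoc, hh]; exact hcp
      exact ⟨fun h => absurd h hhp, fun h => absurd h h1⟩
    · have h1 : h₀ * (c₀ * (h₀ * p)) ∈ Ψ₀ := by
        rw [← mul_assoc, ← hc0h, mul_assoc, ← mul_assoc h₀ h₀, hh, ← mul_assoc, hcc, one_mul]; exact hpΨ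
      exact ⟨fun _ => h1, fun _ => hchp⟩
  have hPc : ∀ x, x ∈ P ↔ c₀ * x ∈ P := fun x => by
    rw [memP, memP]
    constructor
    · rintro (rfl | rfl)
      · exact Or.inr rfl
      · left; rw [← mul_assoc, hcc, one_mul]
    · rintro (h | h)
      · right; rw [← h, ← mul_assoc, hcc, one_mul]
      · left; exact mul_left_cancel h
  have hQc : ∀ x, x ∈ Q ↔ c₀ * x ∈ Q := fun x => by
    rw [memQ, memQ]
    constructor
    · rintro (rfl | rfl)
      · exact Or.inr rfl
      · left; rw [← mul_assoc, hcc, one_mul]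
    · rintro (h | h)
      · right; rw [← h, ← mul_assoc, hcc, one_mul]
      · left; exact mul_left_cancel h
  -- the family
  let fam : ℕ → Finset H := fun k => if k < 2 then Ψ₀ else if k = 2 then symmDiff Ψ₀ P else symmDiff Ψ₀ Q
  let Ψ : (Multiplicative (ZMod 4)) → Finset H := fun v => fam (Multiplicative.toAdd v).val
  have hΨ1 : Ψ 1 = Ψ₀ := by
    show fam (Multiplicative.toAdd (1 : (Multiplicative (ZMod 4)))).val = Ψ₀
    rw [show (Multiplicative.toAdd (1 : (Multiplicative (ZMod 4)))).val = 0 by decide]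
    show (if 0 < 2 then Ψ₀ else if 0 = 2 then symmDiff Ψ₀ P else symmDiff Ψ₀ Q) = Ψ₀
    rw [if_pos (by norm_num)]
  have hΨg : Ψ (Multiplicative.ofAdd (1 : ZMod 4)) = Ψ₀ := by
    show fam (Multiplicative.toAdd (Multiplicative.ofAdd (1 : ZMod 4))).val = Ψ₀
    rw [show (Multiplicative.toAdd (Multiplicative.ofAdd (1 : ZMod 4))).val = 1 by decide]
    show (if 1 < 2 then Ψ₀ else if 1 = 2 then symmDiff Ψ₀ P else symmDiff Ψ₀ Q) = Ψ₀
    rw [if_pos (by norm_num)]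
  have hΨg2 : Ψ ((Multiplicative.ofAdd (1 : ZMod 4)) * (Multiplicative.ofAdd (1 : ZMod 4))) = symmDiff Ψ₀ P := by
    show fam (Multiplicative.toAdd ((Multiplicative.ofAdd (1 : ZMod 4)) * (Multiplicative.ofAdd (1 : ZMod 4)))).val =
        symmDiff Ψ₀ P
    rw [show (Multiplicative.toAdd ((Multiplicative.ofAdd (1 : ZMod 4)) * (Multiplicative.ofAdd (1 : ZMod 4)))).val =
        2 by decide]
    show (if 2 < 2 then Ψ₀ else if 2 = 2 then symmDiff Ψ₀ P else symmDiff Ψ₀ Q) = symmDiff Ψ₀ P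
    rw [if_neg (by norm_num), if_pos rfl]
  have hΨg3 : Ψ ((Multiplicative.ofAdd (1 : ZMod 4)) * (Multiplicative.ofAdd (1 : ZMod 4)) * (Multiplicative.ofAdd (1
      : ZMod 4))) = symmDiff Ψ₀ Q := by
    show fam (Multiplicative.toAdd ((Multiplicative.ofAdd (1 : ZMod 4)) * (Multiplicative.ofAdd (1 : ZMod 4)) *
        (Multiplicative.ofAdd (1 : ZMod 4)))).val = symmDiff Ψ₀ Q
    rw [show (Multiplicative.toAdd ((Multiplicative.ofAdd (1 : ZMod 4)) * (Multiplicative.ofAdd (1 : ZMod 4)) *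
        (Multiplicative.ofAdd (1 : ZMod 4)))).val = 3 by decide]
    show (if 3 < 2 then Ψ₀ else if 3 = 2 then symmDiff Ψ₀ P else symmDiff Ψ₀ Q) = symmDiff Ψ₀ Q
    rw [if_neg (by norm_num), if_neg (by norm_num)]
  -- products in `(Multiplicative (ZMod 4))`
  have g4 : (Multiplicative.ofAdd (1 : ZMod 4)) * (Multiplicative.ofAdd (1 : ZMod 4)) * (Multiplicative.ofAdd (1 :
      ZMod 4)) * (Multiplicative.ofAdd (1 : ZMod 4)) = 1 := by decide
  have memSD : ∀ (S : Finset H) (x : H), x ∈ symmDiff Ψ₀ S ↔ (x ∈ Ψ₀ ↔ x ∉ S) := fun S x => by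
    rw [Finset.mem_symmDiff]; tauto
  -- the type
  set T : Finset (H × (Multiplicative (ZMod 4))) := Finset.univ.filter fun q => q.1 ∈ Ψ q.2 with hT_def
  have hT : ∀ q : H × (Multiplicative (ZMod 4)), q ∈ T ↔ q.1 ∈ Ψ q.2 := fun q => by simp [hT_def]
  -- CM
  have hcmT : ∀ q : H × (Multiplicative (ZMod 4)), q ∈ T ↔ ((c₀, (1 : (Multiplicative (ZMod 4)))) : H ×
      (Multiplicative (ZMod 4))) * q ∉ T := by
    rintro ⟨x, v⟩
    rw [hT, hT, Prod.mk_mul_mk, one_mul]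
    change x ∈ Ψ v ↔ c₀ * x ∉ Ψ v
    rcases cyclicFour_cases v with rfl | rfl | rfl | rfl
    · rw [hΨ1]; exact hcm₀ x
    · rw [hΨg]; exact hcm₀ x
    · rw [hΨg2, memSD, memSD, hcm₀ x, ← hPc]; exact symmDiff_cm_prop' _ _
    · rw [hΨg3, memSD, memSD, hcm₀ x, ← hQc]; exact symmDiff_cm_prop' _ _
  -- trivial left stabiliser
  have hp_notin2 : p ∉ symmDiff Ψ₀ P := fun h => ((memSD P p).1 h).1 hpΨ ((memP p).2 (Or.inl rfl))
  have hprimT : ∀ w : H × (Multiplicative (ZMod 4)), w ≠ 1 → ∃ z : H × (Multiplicative (ZMod 4)), ¬ (z ∈ T ↔ w * z ∈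
      T) := by
    rintro ⟨y, v⟩ hv
    by_contra hall
    push Not at hall
    have row : ∀ (u : (Multiplicative (ZMod 4))) (x : H), x ∈ Ψ u ↔ y * x ∈ Ψ (v * u) := fun u x => by
      have := hall (x, u); rwa [hT, hT, Prod.mk_mul_mk] at this
    have hy1 : (∀ x, x ∈ Ψ₀ ↔ y * x ∈ Ψ₀) → y = 1 := fun h => by
      by_contra hne; obtain ⟨w, hw⟩ := hprim₀ y hne; exact hw (h w)
    rcases cyclicFour_cases v with rfl | rfl | rfl | rfl
    · have : y = 1 := hy1 fun x => by have := row 1 x; rwa [mul_one, hΨ1] at this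
      exact hv (by rw [this]; rfl)
    · have : y = 1 := hy1 fun x => by have := row 1 x; rwa [mul_one, hΨ1, hΨg] at this
      subst this
      have := row (Multiplicative.ofAdd (1 : ZMod 4)) p
      rw [hΨg, hΨg2, one_mul] at this
      exact hp_notin2 (this.1 hpΨ)
    · have h1 := fun x => row 1 x
      have h2 := fun x => row (Multiplicative.ofAdd (1 : ZMod 4)) x
      simp only [mul_one, hΨ1, hΨg2] at h1
      simp only [hΨg, hΨg3] at h2
      -- `y x ∈ Ψ₀ ∆ P ↔ y x ∈ Ψ₀ ∆ Q` for all `x`; take `x = y⁻¹ p`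
      have := (h1 (y⁻¹ * p)).symm.trans (h2 (y⁻¹ * p))
      rw [mul_inv_cancel_left] at this
      have hpQ : p ∉ Q := fun h => hdis p ⟨(memP p).2 (Or.inl rfl), h⟩
      have hpSQ : p ∈ symmDiff Ψ₀ Q := (memSD Q p).2 ⟨fun _ => hpQ, fun _ => hpΨ⟩
      exact hp_notin2 (this.2 hpSQ)
    · have : y = 1 := hy1 fun x => by have := row (Multiplicative.ofAdd (1 : ZMod 4)) x; rwa [hΨg, g4, hΨ1] at this
      subst this
      have := row 1 (h₀ * p)
      rw [mul_one, hΨ1, hΨg3, one_mul] at this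
      have hin : h₀ * p ∈ symmDiff Ψ₀ Q := (memSD Q _).2 ⟨fun h => absurd h hhp, fun h => absurd
        ((memQ _).2 (Or.inl rfl)) h⟩
      exact hhp (this.2 hin)
  -- the balanced diagonal `V = {(1,1), (h₀,g), (c₀,g²), (c₀h₀,g³)}`
  have hbalT : ∀ q : H × (Multiplicative (ZMod 4)), 2 * (({((1 : H), (1 : (Multiplicative (ZMod 4)))), (h₀,
      (Multiplicative.ofAdd (1 : ZMod 4))), (c₀, (Multiplicative.ofAdd (1 : ZMod 4)) * (Multiplicative.ofAdd (1 :
      ZMod 4))), (c₀ * h₀, (Multiplicative.ofAdd (1 : ZMod 4)) * (Multiplicative.ofAdd (1 : ZMod 4)) *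
      (Multiplicative.ofAdd (1 : ZMod 4)))} :
      Finset (H × (Multiplicative (ZMod 4)))).filter fun d => d * q ∈ T).card = 4 := by
    rintro ⟨x, v⟩
    have hn1 : ((1 : H), (1 : (Multiplicative (ZMod 4)))) ∉ ({(h₀, (Multiplicative.ofAdd (1 : ZMod 4))), (c₀,
        (Multiplicative.ofAdd (1 : ZMod 4)) * (Multiplicative.ofAdd (1 : ZMod 4))), (c₀ * h₀, (Multiplicative.ofAdd
        (1 : ZMod 4)) * (Multiplicative.ofAdd (1 : ZMod 4)) * (Multiplicative.ofAdd (1 : ZMod 4)))} : Finset (H ×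
        (Multiplicative (ZMod 4)))) := by
      simp only [Finset.mem_insert, Finset.mem_singleton, Prod.mk.injEq, not_or]
      refine ⟨fun h => ?_, fun h => ?_, fun h => ?_⟩ <;> exact absurd h.2 (by decide)
    have hn2 : (h₀, (Multiplicative.ofAdd (1 : ZMod 4))) ∉ ({(c₀, (Multiplicative.ofAdd (1 : ZMod 4)) *
        (Multiplicative.ofAdd (1 : ZMod 4))), (c₀ * h₀, (Multiplicative.ofAdd (1 : ZMod 4)) * (Multiplicative.ofAdd
        (1 : ZMod 4)) * (Multiplicative.ofAdd (1 : ZMod 4)))} : Finset (H × (Multiplicative (ZMod 4)))) := by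
      simp only [Finset.mem_insert, Finset.mem_singleton, Prod.mk.injEq, not_or]
      refine ⟨fun h => ?_, fun h => ?_⟩ <;> exact absurd h.2 (by decide)
    have hn3 : (c₀, (Multiplicative.ofAdd (1 : ZMod 4)) * (Multiplicative.ofAdd (1 : ZMod 4))) ∉ ({(c₀ * h₀,
        (Multiplicative.ofAdd (1 : ZMod 4)) * (Multiplicative.ofAdd (1 : ZMod 4)) * (Multiplicative.ofAdd (1 : ZMod
        4)))} : Finset (H × (Multiplicative (ZMod 4)))) := by
      simp only [Finset.mem_singleton, Prod.mk.injEq, not_and]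
      exact fun _ h => absurd h (by decide)
    rw [Finset.card_filter, Finset.sum_insert hn1, Finset.sum_insert hn2, Finset.sum_insert hn3,
      Finset.sum_singleton]
    simp only [Prod.mk_mul_mk, one_mul, hT]
    have cA : c₀ * x ∈ Ψ₀ ↔ ¬ x ∈ Ψ₀ := by rw [hcm₀ x, not_not]
    have cB : c₀ * h₀ * x ∈ Ψ₀ ↔ ¬ h₀ * x ∈ Ψ₀ := by rw [mul_assoc, hcm₀ (h₀ * x), not_not]
    have cP : c₀ * x ∈ P ↔ x ∈ P := (hPc x).symm
    have cQ : c₀ * x ∈ Q ↔ x ∈ Q := (hQc x).symm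
    have hP' : h₀ * x ∈ Q ↔ x ∈ P := (hPQ x).symm
    have hQ' : h₀ * x ∈ P ↔ x ∈ Q := (hQP x).symm
    have chP : c₀ * h₀ * x ∈ P ↔ x ∈ Q := by rw [mul_assoc, ← hPc]; exact hQ'
    have chQ : c₀ * h₀ * x ∈ Q ↔ x ∈ P := by rw [mul_assoc, ← hQc]; exact hP'
    have e1 : (Multiplicative.ofAdd (1 : ZMod 4)) * ((Multiplicative.ofAdd (1 : ZMod 4)) * (Multiplicative.ofAdd (1 :
        ZMod 4))) = (Multiplicative.ofAdd (1 : ZMod 4)) * (Multiplicative.ofAdd (1 : ZMod 4)) * (Multiplicative.ofAdd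
        (1 : ZMod 4)) := by decide
    have e2 : (Multiplicative.ofAdd (1 : ZMod 4)) * (Multiplicative.ofAdd (1 : ZMod 4)) * ((Multiplicative.ofAdd (1 :
        ZMod 4)) * (Multiplicative.ofAdd (1 : ZMod 4))) = 1 := by decide
    have e3 : (Multiplicative.ofAdd (1 : ZMod 4)) * (Multiplicative.ofAdd (1 : ZMod 4)) * (Multiplicative.ofAdd (1 :
        ZMod 4)) * ((Multiplicative.ofAdd (1 : ZMod 4)) * (Multiplicative.ofAdd (1 : ZMod 4))) =
        (Multiplicative.ofAdd (1 : ZMod 4)) := by decide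
    have e4 : (Multiplicative.ofAdd (1 : ZMod 4)) * ((Multiplicative.ofAdd (1 : ZMod 4)) * (Multiplicative.ofAdd (1 :
        ZMod 4)) * (Multiplicative.ofAdd (1 : ZMod 4))) = 1 := by decide
    have e5 : (Multiplicative.ofAdd (1 : ZMod 4)) * (Multiplicative.ofAdd (1 : ZMod 4)) * ((Multiplicative.ofAdd (1 :
        ZMod 4)) * (Multiplicative.ofAdd (1 : ZMod 4)) * (Multiplicative.ofAdd (1 : ZMod 4))) = (Multiplicative.ofAdd
        (1 : ZMod 4)) := by decide
    have e6 : (Multiplicative.ofAdd (1 : ZMod 4)) * (Multiplicative.ofAdd (1 : ZMod 4)) * (Multiplicative.ofAdd (1 :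
        ZMod 4)) * ((Multiplicative.ofAdd (1 : ZMod 4)) * (Multiplicative.ofAdd (1 : ZMod 4)) * (Multiplicative.ofAdd
        (1 : ZMod 4))) = (Multiplicative.ofAdd (1 : ZMod 4)) * (Multiplicative.ofAdd (1 : ZMod 4)) := by decide
    have hdx := hdis x
    have hsPx := hsP x
    have hsQx := hsQ x
    rcases cyclicFour_cases v with rfl | rfl | rfl | rfl <;>
      simp only [mul_one, g4, e1, e2, e3, e4, e5, e6, hΨ1, hΨg, hΨg2, hΨg3, memSD, cA, cB, cP, cQ, hP', hQ', chP,
        chQ] <;>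
      clear * - hdx hsPx hsQx <;>
      by_cases hA : x ∈ Ψ₀ <;> by_cases hB : h₀ * x ∈ Ψ₀ <;> by_cases hPx : x ∈ P <;> by_cases hQx : x ∈ Q <;>
      simp_all
  have hmain := exists_simple_degenerate_of_model_balanced e (c₀, 1) hc T hcmT hprimT
    {((1 : H), (1 : (Multiplicative (ZMod 4)))), (h₀, (Multiplicative.ofAdd (1 : ZMod 4))), (c₀,
        (Multiplicative.ofAdd (1 : ZMod 4)) * (Multiplicative.ofAdd (1 : ZMod 4))), (c₀ * h₀, (Multiplicative.ofAdd
        (1 : ZMod 4)) * (Multiplicative.ofAdd (1 : ZMod 4)) * (Multiplicative.ofAdd (1 : ZMod 4)))}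
    (fun q => by
      rw [hbalT q, Finset.card_insert_of_notMem, Finset.card_insert_of_notMem, Finset.card_insert_of_notMem,
        Finset.card_singleton]
      · simp only [Finset.mem_singleton, Prod.mk.injEq, not_and]
        exact fun _ h => absurd h (by decide)
      · simp only [Finset.mem_insert, Finset.mem_singleton, Prod.mk.injEq, not_or]
        refine ⟨fun h => ?_, fun h => ?_⟩ <;> exact absurd h.2 (by decide)
      · simp only [Finset.mem_insert, Finset.mem_singleton, Prod.mk.injEq, not_or]
        refine ⟨fun h => ?_, fun h => ?_, fun h => ?_⟩ <;> exact absurd h.2 (by decide))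
    ⟨((1 : H), (1 : (Multiplicative (ZMod 4)))), by simp, by
      rw [Prod.mk_mul_mk, mul_one, mul_one]
      simp only [Finset.mem_insert, Finset.mem_singleton, Prod.mk.injEq, not_or]
      exact ⟨fun h => hc1 h.1, fun h => absurd h.2 (by decide), fun h => absurd h.2 (by decide),
        fun h => absurd h.2 (by decide)⟩⟩
  rwa [Fintype.card_prod, show Fintype.card (Multiplicative (ZMod 4)) = 4 by rfl, show Fintype.card H * 4 / 2 = 2 *
      Fintype.card H by
    omega] at hmain

/-! ## §2 `Q_{4n} × C₄` -/

/-- **THEOREM (`Q_{4n} × C₄`, every `n ≥ 1`).**  `K` Galois CM with `Gal(K/ℚ) ≅ Q_{4n} ×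
    C₄` (`QuaternionGroup n`)
and complex conjugation `(aⁿ, 1)` — `K = K₁ L`, `K₁` a `Q_{4n}`-CM field, `L` a real cyclic quartic field, disjoint:
`K` has a SIMPLE DEGENERATE abelian variety of dimension `8n` with CM by `K`, with an exceptional Hodge class on some
power (`h₀ = xa 0`, `(xa 0)² = aⁿ`; the double interval of part VII-b, Weil type over the diagonal `(Multiplicative
    (ZMod 4))`).  In contrast
`Q_{2^{k+2}} × C₂` with `c` in the quaternion factor is good (gen 20). [cite: Shimura1998, §6.2 Thm. 3 and §8.2
Prop. 26] [cite: Gordon1999HodgeAVSurvey, Thm. 6.4 and §9.2] -/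
theorem exists_simple_degenerate_of_quaternion_cyclicFour {n : ℕ} (h1 : 1 ≤ n)
    (e : (K ≃ₐ[ℚ] K) ≃* QuaternionGroup n × (Multiplicative (ZMod 4)))
    (hc : e ((IsCMField.complexConj K).restrictScalars ℚ) = (a n, 1)) :
    ∃ (Φ : CMType K) (φ₀ : K →+* ℂ) (A : AbelianVariety ℂ) (ι : 𝓞 K →+* End A)
      (θ : K →+* Module.End ℂ (complexBetti A.X 1)),
      IsPrimitive (ℂ ≃+* ℂ) Φ.1 φ₀ ∧ ¬ IsNondegenerate Φ ∧ IsCMTypeRealisation Φ A ι θ ∧ A.IsSimple ∧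
      A.dim = 8 * n ∧
      ∃ n p : ℕ, ∃ x : complexBetti (⨁ fun _ : Fin n => A).X (2 * p), IsRationalClass x ∧
        IsOfHodgeType (⨁ fun _ : Fin n => A).dim (⨁ fun _ : Fin n => A).X (2 * p) p p x ∧
        x ∉ divisorClassesSpan (⨁ fun _ : Fin n => A).X (⨁ fun _ : Fin n => A).dim p := by
  classical
  haveI : NeZero n := ⟨by omega⟩
  obtain ⟨Ψ₀, hA, hX⟩ := exists_quaternionDoubleInterval (n := n)
  have hsq : (xa (0 : ZMod (2 * n)) : QuaternionGroup n) * xa 0 = a n := by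
    rw [xa_mul_xa, add_zero, sub_zero]
  have hmain := exists_simple_degenerate_of_model_cyclicFour e (a n) hc (xa 0) hsq Ψ₀
    (quaternion_doubleInterval_cm hA hX) (quaternion_doubleInterval_leftStabiliser hA hX)
  rwa [QuaternionGroup.card, show 2 * (4 * n) = 8 * n by ring] at hmain

end CyclicFour

end Summit.HodgeConjecture.CorCM.GaloisModels

end
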